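import Mathlib.RingTheory.RootsOfUnity.Complex
import Literature.Computability.AlgebraicComplexity.BDI20WidthChainProofs
import Literature.Computability.AlgebraicComplexity.MS2001ClassVarieties
import HarnessLib

/-!
# BDI Cor 6.8 (arXiv Cor 14): `WR(x^{d-1}y) = d`, `W̲R(x^{d-1}y) ≤ 2`, the strict inclusion
# `W_{2,d} ⊊ W̲_{2,d}` — and Question 6.9 (a) (arXiv Question 15, first alternative) AS TYPED: no
(theorem-only file; cell `val-lit`, seat x6; no definitions, no named facts)

[BlaserDorflerIkenmeyer2020] Cor 14 (= CCC 2021 Cor 6.8) orders the sets of symmetric tensors of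
small Waring rank `W_{k,d}`, small border Waring rank `W̲_{k,d}` and small noncommutative-ABP width
`B_{k,d}`: `W_{k,d} ⊆ W̲_{k,d} ⊆ B_{k,d} = B̲_{k,d}`, "and there exist `k, d` for which the
inclusions are strict". The printed witness of the first strict inclusion is the form `x^{d-1} y`:
"we refer to [carlini2012solution] showing that `x^{d-1} y` has Waring rank `d` while it is known
that `x^{d-1} y = lim_{ε→0} (1/(dε)) ((x+εy)^d − x^d)` and thus `x^{d-1} y` has border Waring rank
at most `2`" (arXiv p0012.txt:L36; CCC p.29:13). This file PROVES both halves over the tree's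
`polyWaringRank` / `borderPolyWaringRank` (the statement file `BDI20WaringRankABPWidth.lean` lists
"Cor 6.7/6.8's strictness examples" as NOT typed; the first of them is now typed AND proved):

* `BDI20WaringGap.polyWaringRank_X_pow_mul_X_eq` — **`WR(x^{d-1} y) = d`** over `ℂ`
  ([CarliniCatalisanoGeramita2012], rank of monomials, the case `x_1^{1} x_2^{d-1}`:
  `(b_2 + 1) = d`). Lower bound over any field of characteristic `0`
  (`le_of_sum_linearForm_pow_eq`: every Waring decomposition of `x^{d-1} y` has `≥ d` terms) by
  apolarity done by hand — the derivation `b ∂_x − a ∂_y` kills `(a x + b y)^d`, maps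
  `α x^e y + β x^{e+1}` to the same shape one degree lower with `α ↦ α b e ≠ 0`, and `∂_y` detects
  `α` (`succ_le_card_filter_of_normalForm_eq_sum`); upper bound by the explicit decomposition on the
  `d`-th roots of unity `∑_{k<d} ζ^{k(d-1)} (x + ζ^k y)^d = d² x^{d-1} y` (the printed apolar
  points `(y_2^{d} − y_1^{d})`; `sum_rootOfUnity_mul_pow_eq`).
* `BDI20WaringGap.isBorderWaringRankLE_two_X_pow_mul_X` — **`W̲R(x^{d-1} y) ≤ 2`** over an
  algebraically closed field of characteristic `0`: the family
  `F(t) = ∑_{m<d} (binom(d,m+1)/d) t^m x^{d-1-m} y^{m+1} ∈ F[t][x,y]` has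
  `F(t) = (1/(dt))((x+ty)^d − x^d) = (μ(x+ty))^d + (ν x)^d` (`μ^d = 1/(dt)`, `ν^d = −1/(dt)`) for
  `t ≠ 0` and `F(0) = x^{d-1} y`, so the tree's one-parameter-family lemma
  `coeffVec_map_eval_zero_mem_zariskiClosure_of_family` puts `x^{d-1} y` in the Zariski closure of
  the sums of two `d`-th powers.
* `BDI20WaringGap.ncAbpWidthPoly_X_pow_mul_X_le_two` — `ncw(x^{d-1} y) ≤ 2` over `ℂ`, from the
  PROVED chain `w ≤ ncw ≤ W̲R` (`BDI2020_thm_4_2_chain_holds`).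
* `BDI2020_cor_6_8_waring_lt_border` — the first strict inclusion of Cor 6.8 as printed:
  `W̲R(x^{d-1} y) ≤ 2 < WR(x^{d-1} y)` for every `d ≥ 3`.
* `not_BDI2020_question_6_9a` — **Question 6.9 (a) decided as typed.** The typed
  `BDI2020_question_6_9a` ("Is there a polynomial `q`, such that `B_{k,d} ⊆ W_{q(k),d}` …?", read
  literally: ONE `q(k)`, uniform in `d` and `m`) fails at `k = 2`, `d = q(2) + 1`, `p = x^{d-1} y`:
  `ncw(p) ≤ 2` but `WR(p) = d > q(2)`.

HONEST SCOPE. (1) What is refuted is the typed, `d`-uniform reading of the first alternative, by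
the example the paper itself prints two sentences earlier; a reading in which `q` may depend
polynomially on `d` as well is NOT addressed, and the second alternative `BDI2020_question_6_9b`
(`B_{k,d} ⊆ W̲_{q(k),d}`, border Waring rank polynomial in the ncABP width) is untouched — open, as
printed ("Note that the following is still unknown"). (2) The second strict inclusion of Cor 6.8
(`W̲_{k,d} ≠ B_{k,d}`, the `2 × 2` matrix-multiplication cubic with `ncw = 4 < 5 ≤ W̲R` by a Young
flattening / Macaulay2) is not formalised here. (3) Typed ≠ endorsed; `VP ≠ VNP` is NOT proved and
nothing here bears on it (LADDER-VALIANT V4, row N4 "constructivity side", ideation only).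

## References
* [BlaserDorflerIkenmeyer2020] M. Bläser, J. Dörfler, C. Ikenmeyer, *On the complexity of
  evaluating highest weight vectors*, arXiv:2002.11594 = CCC 2021 (LIPIcs 200:29), Cor 14 and
  Question 15 (= CCC Cor 6.8, Question 6.9); locators paper:arxiv-2002.11594 p0012.txt:L21-36
  (Cor 14 with proof), L63-66 (Question 15); CCC p.29:13–29:14.
* [CarliniCatalisanoGeramita2012] E. Carlini, M. V. Catalisano, A. V. Geramita, *The solution to
  the Waring problem for monomials and the sum of coprime monomials*, J. Algebra 370 (2012) 5–14
  = arXiv:1110.0745, Cor 3.3 (rank of monomials `x_1^{b_1}⋯x_m^{b_m}`, `b_1 ≤ … ≤ b_m`, is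
  `∏_{i≥2}(b_i+1)`; held text paper:arxiv-1110.0745 p0005.txt:L61-90, apolar points
  `(y_2^{b_2+1} − y_1^{b_2+1}, …)`).
* [LandsbergGCT2017] J. M. Landsberg, *Geometry and complexity theory*, CUP 2017, §6.2.2 (border
  Waring rank; the tree's `IsBorderWaringRankLE` / `borderPolyWaringRank`).
-/

noncomputable section

open MvPolynomial Finset
open scoped BigOperators Classical

namespace Literature.Computability.AlgebraicComplexity

namespace BDI20WaringGap

variable {F : Type*} [Field F]

/-! ### Binary linear forms and the apolar derivation `b ∂_x − a ∂_y` -/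

/-- `1 ≠ 0` in `Fin 2`. [folklore] -/
private theorem fin2_one_ne_zero : (1 : Fin 2) ≠ 0 := by decide

/-- `0 ≠ 1` in `Fin 2`. [folklore] -/
private theorem fin2_zero_ne_one : (0 : Fin 2) ≠ 1 := by decide

/-- `∂_x (a x + b y) = a`. [folklore] -/
private theorem pderiv_zero_lin (a b : F) :
    pderiv 0 (C a * X 0 + C b * X 1 : MvPolynomial (Fin 2) F) = C a := by
  rw [map_add, pderiv_C_mul, pderiv_C_mul, pderiv_X_self, pderiv_X_of_ne fin2_one_ne_zero,
    mul_one, mul_zero, add_zero]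

/-- `∂_y (a x + b y) = b`. [folklore] -/
private theorem pderiv_one_lin (a b : F) :
    pderiv 1 (C a * X 0 + C b * X 1 : MvPolynomial (Fin 2) F) = C b := by
  rw [map_add, pderiv_C_mul, pderiv_C_mul, pderiv_X_self, pderiv_X_of_ne fin2_zero_ne_one,
    mul_one, mul_zero, zero_add]

/-- The derivation `b₀ ∂_x − a₀ ∂_y` sends `c · (a x + b y)^{n+1}` to
`c (n+1) (b₀ a − a₀ b) · (a x + b y)^n`; in particular it kills the powers of `a₀ x + b₀ y`
(the point `[a₀ : b₀]` is apolar to the powers of its own form: the variables of the dual ring act as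
`∂/∂x`, `∂/∂y`). [cite: CarliniCatalisanoGeramita2012, §2 and Lemma 2.1 (Apolarity Lemma; arXiv:1110.0745 p0004.txt:L13-30)] -/
theorem apolar_C_mul_linPow (a₀ b₀ c a b : F) (n : ℕ) :
    C b₀ * pderiv 0 (C c * (C a * X 0 + C b * X 1) ^ (n + 1) : MvPolynomial (Fin 2) F) -
      C a₀ * pderiv 1 (C c * (C a * X 0 + C b * X 1) ^ (n + 1) : MvPolynomial (Fin 2) F) =
    C (c * (n + 1 : ℕ) * (b₀ * a - a₀ * b)) * (C a * X 0 + C b * X 1) ^ n := by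
  rw [pderiv_C_mul, pderiv_C_mul, pderiv_pow, pderiv_pow, pderiv_zero_lin, pderiv_one_lin,
    Nat.add_sub_cancel]
  simp only [map_mul, map_sub, map_natCast]
  ring

/-- The derivation applied to a sum of weighted powers of linear forms. [cite: CarliniCatalisanoGeramita2012, §2 and Lemma 2.1 (Apolarity Lemma; arXiv:1110.0745 p0004.txt:L13-30)] -/
theorem apolar_sum {ι : Type*} (a₀ b₀ : F) (J : Finset ι) (c a b : ι → F) (n : ℕ) :
    C b₀ * pderiv 0 (∑ i ∈ J, C (c i) * (C (a i) * X 0 + C (b i) * X 1) ^ (n + 1) :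
        MvPolynomial (Fin 2) F) -
      C a₀ * pderiv 1 (∑ i ∈ J, C (c i) * (C (a i) * X 0 + C (b i) * X 1) ^ (n + 1) :
        MvPolynomial (Fin 2) F) =
    ∑ i ∈ J, C (c i * (n + 1 : ℕ) * (b₀ * a i - a₀ * b i)) * (C (a i) * X 0 + C (b i) * X 1) ^ n := by
  rw [map_sum, map_sum, mul_sum, mul_sum, ← sum_sub_distrib]
  exact sum_congr rfl fun i _ => apolar_C_mul_linPow a₀ b₀ (c i) (a i) (b i) n

/-- The derivation `b₀ ∂_x − a₀ ∂_y` on the normal form `α x^{e+1} y + β x^{e+2}` (`∂_y²` kills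
`x^{d-1} y`: its apolar ideal is `(∂_y², ∂_x^d)`). [cite: CarliniCatalisanoGeramita2012, Cor 3.3, proof (`F^⊥ = (y_1^{b_1+1}, …, y_n^{b_n+1})`; arXiv:1110.0745 p0005.txt:L68-74)] -/
theorem apolar_normalForm (a₀ b₀ α β : F) (e : ℕ) :
    C b₀ * pderiv 0 (C α * X 0 ^ (e + 1) * X 1 + C β * X 0 ^ (e + 2) : MvPolynomial (Fin 2) F) -
      C a₀ * pderiv 1 (C α * X 0 ^ (e + 1) * X 1 + C β * X 0 ^ (e + 2) : MvPolynomial (Fin 2) F) =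
    C (b₀ * α * (e + 1 : ℕ)) * X 0 ^ e * X 1 + C (b₀ * β * (e + 2 : ℕ) - a₀ * α) * X 0 ^ (e + 1) := by
  simp only [map_add, pderiv_mul, pderiv_C, pderiv_pow, pderiv_X_self, pderiv_X_of_ne fin2_one_ne_zero,
    pderiv_X_of_ne fin2_zero_ne_one, zero_mul, zero_add, mul_zero, add_zero, mul_one,
    Nat.add_sub_cancel, show e + 2 - 1 = e + 1 from rfl, map_mul, map_sub, map_natCast]
  ring

/-- `∂_y (α x^e y + β x^{e+1}) = α x^e`. [folklore] -/
private theorem pderiv_one_normalForm (α β : F) (e : ℕ) :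
    pderiv 1 (C α * X 0 ^ e * X 1 + C β * X 0 ^ (e + 1) : MvPolynomial (Fin 2) F) = C α * X 0 ^ e := by
  simp only [map_add, pderiv_mul, pderiv_C, pderiv_pow, pderiv_X_self,
    pderiv_X_of_ne fin2_zero_ne_one, zero_mul, zero_add, mul_zero, add_zero, mul_one]


/-- `α x^e = 0` forces `α = 0`. [folklore] -/
private theorem eq_zero_of_C_mul_X_pow_eq_zero {α : F} {e : ℕ}
    (h : (C α * X 0 ^ e : MvPolynomial (Fin 2) F) = 0) : α = 0 := by
  rw [C_mul_X_pow_eq_monomial, monomial_eq_zero] at h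
  exact h

/-- **The counting lemma** (apolarity by hand). If `α x^e y + β x^{e+1}` with `α ≠ 0` is a
weighted sum `∑_{i ∈ J} c_i (a_i x + b_i y)^{e+1}` of `(e+1)`-st powers of linear forms over a
field of characteristic `0`, then at least `e + 1` of the forms have `b_i ≠ 0`. Induction on `e`:
if no `b_i ≠ 0` occurs, `∂_y` gives `α x^e = 0`; otherwise pick `b_{i₀} ≠ 0` and apply the
derivation `b_{i₀} ∂_x − a_{i₀} ∂_y`, which kills the `i₀`-th power, keeps the shape of both
sides and multiplies `α` by `b_{i₀} (e+1) ≠ 0`. (The classical statement: the apolar ideal of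
`x^{d-1} y` contains no ideal of fewer than `d` distinct points, [CCG12] Thm 3.1 / Cor 3.3 with
`F^⊥ = (∂_y^2, ∂_x^d)`; here without the Apolarity Lemma, by induction on the degree.)
[cite: CarliniCatalisanoGeramita2012, Thm 3.1 and Cor 3.3 (arXiv:1110.0745 p0005.txt:L3-8, L61-79)] -/
theorem succ_le_card_filter_of_normalForm_eq_sum [CharZero F] {ι : Type*} [DecidableEq ι] (e : ℕ) :
    ∀ (J : Finset ι) (c a b : ι → F) (α β : F), α ≠ 0 →
      (C α * X 0 ^ e * X 1 + C β * X 0 ^ (e + 1) : MvPolynomial (Fin 2) F) =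
        ∑ i ∈ J, C (c i) * (C (a i) * X 0 + C (b i) * X 1) ^ (e + 1) →
      e + 1 ≤ (J.filter fun i => b i ≠ 0).card := by
  induction e with
  | zero =>
    intro J c a b α β hα h
    by_contra hlt
    have hJ : ∀ i ∈ J, b i = 0 := by
      intro i hi
      by_contra hb
      exact hlt (card_pos.2 ⟨i, mem_filter.2 ⟨hi, hb⟩⟩)
    apply hα
    have h1 := congrArg (pderiv (1 : Fin 2)) h
    rw [pderiv_one_normalForm, map_sum] at h1
    refine eq_zero_of_C_mul_X_pow_eq_zero (e := 0) (h1.trans (sum_eq_zero fun i hi => ?_))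
    rw [pderiv_C_mul, pderiv_pow, pderiv_one_lin, hJ i hi, C_0, mul_zero, mul_zero]
  | succ e ih =>
    intro J c a b α β hα h
    by_cases hex : ∃ i ∈ J, b i ≠ 0
    · obtain ⟨i₀, hi₀, hb₀⟩ := hex
      -- apply the derivation `b_{i₀} ∂_x − a_{i₀} ∂_y` to both sides
      have h' := congrArg (fun f : MvPolynomial (Fin 2) F => C (b i₀) * pderiv 0 f - C (a i₀) * pderiv 1 f) h
      rw [apolar_normalForm, apolar_sum,
        ← sum_erase J (a := i₀) (by rw [show b i₀ * a i₀ - a i₀ * b i₀ = 0 by ring, mul_zero, C_0,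
          zero_mul])] at h'
      have hα' : b i₀ * α * ((e + 1 : ℕ) : F) ≠ 0 :=
        mul_ne_zero (mul_ne_zero hb₀ hα) (Nat.cast_ne_zero.2 (Nat.succ_ne_zero e))
      have hih := ih (J.erase i₀) _ a b _ _ hα' h'
      rw [filter_erase, card_erase_of_mem (mem_filter.2 ⟨hi₀, hb₀⟩)] at hih
      have hpos : 0 < (J.filter fun i => b i ≠ 0).card := card_pos.2 ⟨i₀, mem_filter.2 ⟨hi₀, hb₀⟩⟩
      omega
    · push Not at hex
      exfalso
      apply hα
      have h1 := congrArg (pderiv (1 : Fin 2)) h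
      rw [pderiv_one_normalForm, map_sum] at h1
      refine eq_zero_of_C_mul_X_pow_eq_zero (e := e + 1) (h1.trans (sum_eq_zero fun i hi => ?_))
      rw [pderiv_C_mul, pderiv_pow, pderiv_one_lin, hex i hi, C_0, mul_zero, mul_zero]

/-- `ℓ_v = v₀ x + v₁ y`: the tree's `linearForm` (EGOW Def 4.1, `∑ᵢ aᵢ xᵢ`) in two variables. [cite: EfremenkoGargOliveiraWigderson2018, Def 4.1] -/
theorem linearForm_fin_two (v : Fin 2 → F) :
    linearForm v = (C (v 0) * X 0 + C (v 1) * X 1 : MvPolynomial (Fin 2) F) := by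
  unfold linearForm
  rw [Fin.sum_univ_two]

/-- **Every Waring decomposition of `x^{d-1} y` has at least `d` terms** (characteristic `0`).
[cite: CarliniCatalisanoGeramita2012, Cor 3.3 (rank of monomials, arXiv:1110.0745 p0005.txt:L61-66; `x^{d-1}y = x_1^{1} x_2^{d-1}`: `b_2 + 1 = d`)] -/
theorem le_of_sum_linearForm_pow_eq [CharZero F] {d s : ℕ} (v : Fin s → Fin 2 → F)
    (h : ∑ i, linearForm (v i) ^ d = (X 0 ^ (d - 1) * X 1 : MvPolynomial (Fin 2) F)) : d ≤ s := by
  rcases Nat.eq_zero_or_pos d with rfl | hd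
  · exact Nat.zero_le _
  obtain ⟨e, rfl⟩ : ∃ e, d = e + 1 := ⟨d - 1, (Nat.sub_add_cancel hd).symm⟩
  have h' : (C (1 : F) * X 0 ^ e * X 1 + C 0 * X 0 ^ (e + 1) : MvPolynomial (Fin 2) F) =
      ∑ i ∈ (univ : Finset (Fin s)), C (1 : F) * (C (v i 0) * X 0 + C (v i 1) * X 1) ^ (e + 1) := by
    rw [C_1, one_mul, C_0, zero_mul, add_zero, Nat.add_sub_cancel] at *
    rw [← h]
    exact sum_congr rfl fun i _ => by rw [one_mul, linearForm_fin_two]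
  exact (succ_le_card_filter_of_normalForm_eq_sum e univ (fun _ => (1 : F)) (fun i => v i 0)
    (fun i => v i 1) 1 0 one_ne_zero h').trans ((card_filter_le _ _).trans (card_fin s).le)


/-- `x^{d-1} y ∈ Sym^d V` is a form of degree `d` (`d ≥ 1`), the witness of Cor 14. [cite: BlaserDorflerIkenmeyer2020, Cor 14 (arXiv; = CCC 2021 Cor 6.8), proof] -/
theorem isHomogeneous_X_pow_mul_X {d : ℕ} (hd : 0 < d) :
    (X 0 ^ (d - 1) * X 1 : MvPolynomial (Fin 2) F).IsHomogeneous d := by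
  have h := (isHomogeneous_X_pow (R := F) (0 : Fin 2) (d - 1)).mul (isHomogeneous_X F (1 : Fin 2))
  rwa [Nat.sub_add_cancel hd] at h

/-- **`WR(x^{d-1} y) ≥ d`** for the tree's Waring rank `polyWaringRank` (over an algebraically
closed field of characteristic `0`, where every form has a Waring decomposition, so that the
infimum is over a nonempty set). [cite: CarliniCatalisanoGeramita2012, Cor 3.3 (rank of monomials, arXiv:1110.0745 p0005.txt:L61-66; `x^{d-1}y = x_1^{1} x_2^{d-1}`: `b_2 + 1 = d`)] -/
theorem le_polyWaringRank_X_pow_mul_X [IsAlgClosed F] [CharZero F] (d : ℕ) :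
    d ≤ polyWaringRank d (X 0 ^ (d - 1) * X 1 : MvPolynomial (Fin 2) F) := by
  rcases Nat.eq_zero_or_pos d with rfl | hd
  · exact Nat.zero_le _
  obtain ⟨r, a, ha⟩ := exists_mem_waringSums_of_isHomogeneous hd (isHomogeneous_X_pow_mul_X (F := F) hd)
  unfold polyWaringRank sComplexity
  refine le_csInf ⟨r, fun i => linearForm (a i) ^ d, fun i => ⟨a i, rfl⟩, ha⟩ ?_
  rintro s ⟨g, hg, hsum⟩
  choose v hv using hg
  refine le_of_sum_linearForm_pow_eq v ?_
  rw [← hsum]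
  exact sum_congr rfl fun i _ => hv i

/-! ### The border Waring rank of `x^{d-1} y` is at most `2`: the tangent line to the Veronese -/

/-- The binomial identity behind the degeneration:
`(x + t y)^d − x^d = d t · ∑_{m<d} (binom(d,m+1)/d) t^m x^{d-1-m} y^{m+1}` (characteristic `0`) —
the polynomial-in-`ε` form of the printed `(1/(dε)) ((x + εy)^d − x^d)`.
[cite: BlaserDorflerIkenmeyer2020, Cor 14 (arXiv; = CCC 2021 Cor 6.8), proof, p0012.txt:L36] -/
theorem X_add_C_mul_X_pow_sub [CharZero F] (d : ℕ) (t : F) :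
    ((X 0 + C t * X 1) ^ d - X 0 ^ d : MvPolynomial (Fin 2) F) =
      C ((d : F) * t) * ∑ m ∈ range d,
        C (((d.choose (m + 1) : ℕ) : F) / d * t ^ m) * X 0 ^ (d - 1 - m) * X 1 ^ (m + 1) := by
  rcases Nat.eq_zero_or_pos d with rfl | hd
  · simp
  have hdF : (d : F) ≠ 0 := Nat.cast_ne_zero.2 hd.ne'
  rw [add_pow, sum_range_succ, Nat.sub_self, pow_zero, mul_one, Nat.choose_self, Nat.cast_one,
    mul_one, add_sub_cancel_right, mul_sum, ← sum_range_reflect]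
  refine sum_congr rfl fun m hm => ?_
  have hm' : m < d := mem_range.1 hm
  have h1 : d - (d - 1 - m) = m + 1 := by omega
  have h2 : d.choose (d - 1 - m) = d.choose (m + 1) := by
    rw [show d - 1 - m = d - (m + 1) by omega, Nat.choose_symm (by omega)]
  rw [h1, h2, mul_pow, ← C_pow]
  simp only [← mul_assoc]
  rw [show (X 0 : MvPolynomial (Fin 2) F) ^ (d - 1 - m) * C (t ^ (m + 1)) * X 1 ^ (m + 1) *
      ((d.choose (m + 1) : ℕ) : MvPolynomial (Fin 2) F) =
      C (t ^ (m + 1) * (d.choose (m + 1) : ℕ)) * X 0 ^ (d - 1 - m) * X 1 ^ (m + 1) by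
    rw [C_mul, map_natCast]; ring,
    ← C_mul]
  congr 2
  field_simp
  ring

/-- For `t ≠ 0` the member `(1/(d t)) ((x + t y)^d − x^d)` of the degeneration is a sum of TWO
`d`-th powers of linear forms over an algebraically closed field (absorb the scalars `± 1/(d t)`
by `d`-th roots). [cite: LandsbergGCT2017, §6.2.2 (held PDF p. 158)] -/
theorem family_mem_waringSums_two [IsAlgClosed F] [CharZero F] {d : ℕ} (hd : 0 < d) {t : F}
    (ht : t ≠ 0) :
    (∑ m ∈ range d, C (((d.choose (m + 1) : ℕ) : F) / d * t ^ m) * X 0 ^ (d - 1 - m) * X 1 ^ (m + 1) :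
      MvPolynomial (Fin 2) F) ∈ waringSums F 2 d 2 := by
  have hdt : (d : F) * t ≠ 0 := mul_ne_zero (Nat.cast_ne_zero.2 hd.ne') ht
  obtain ⟨μ, hμ⟩ := IsAlgClosed.exists_pow_nat_eq ((d : F) * t)⁻¹ hd
  obtain ⟨ν, hν⟩ := IsAlgClosed.exists_pow_nat_eq (-((d : F) * t)⁻¹) hd
  refine ⟨![μ • ![1, t], ![ν, 0]], ?_⟩
  rw [Fin.sum_univ_two]
  simp only [Matrix.cons_val_zero, Matrix.cons_val_one, linearForm_fin_two,
    Pi.smul_apply, smul_eq_mul, mul_one]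
  -- `(μ x + μ t y)^d + (ν x)^d = μ^d (x + t y)^d + ν^d x^d = (1/(dt)) ((x + t y)^d - x^d)`
  have e1 : (C μ * X 0 + C (μ * t) * X 1 : MvPolynomial (Fin 2) F) = C μ * (X 0 + C t * X 1) := by
    rw [C_mul]; ring
  rw [e1, C_0, zero_mul, add_zero, mul_pow, mul_pow, ← C_pow, ← C_pow, hμ, hν, C_neg, neg_mul,
    ← sub_eq_add_neg, ← mul_sub, X_add_C_mul_X_pow_sub, ← mul_assoc, ← C_mul, inv_mul_cancel₀ hdt,
    C_1, one_mul]

/-- **`W̲R(x^{d-1} y) ≤ 2`**: `x^{d-1} y = lim_{t → 0} (1/(d t)) ((x + t y)^d − x^d)` lies in the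
Zariski closure of the sums of two `d`-th powers (the point of the tangent line to the Veronese
through `x^d`; the first example of border rank `<` rank: "it is known that `x^{d-1} y =
lim_{ε→0} (1/(dε)) ((x + εy)^d − x^d)` and thus `x^{d-1} y` has border Waring rank at most `2`",
BDI proof of Cor 14). Over an algebraically closed field of characteristic `0`, for the tree's
`IsBorderWaringRankLE` (Zariski closure in coefficient space).
[cite: BlaserDorflerIkenmeyer2020, Cor 14 (arXiv; = CCC 2021 Cor 6.8), proof] locator:
paper:arxiv-2002.11594 p0012.txt:L36; cf. [LandsbergGCT2017, §6.2.2]. -/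
theorem isBorderWaringRankLE_two_X_pow_mul_X [IsAlgClosed F] [CharZero F] {d : ℕ} (hd : 0 < d) :
    IsBorderWaringRankLE d 2 (X 0 ^ (d - 1) * X 1 : MvPolynomial (Fin 2) F) := by
  -- the one-parameter family, with coefficients polynomial in `T`
  set Fam : MvPolynomial (Fin 2) (Polynomial F) :=
    ∑ m ∈ range d, C (Polynomial.C (((d.choose (m + 1) : ℕ) : F) / d) * Polynomial.X ^ m) *
      X 0 ^ (d - 1 - m) * X 1 ^ (m + 1) with hFam
  have hmap : ∀ t : F, MvPolynomial.map (Polynomial.evalRingHom t) Fam =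
      ∑ m ∈ range d, C (((d.choose (m + 1) : ℕ) : F) / d * t ^ m) * X 0 ^ (d - 1 - m) * X 1 ^ (m + 1) := by
    intro t
    simp only [hFam, map_sum, map_mul, map_pow, map_X, map_C, Polynomial.coe_evalRingHom,
      Polynomial.eval_C, Polynomial.eval_X]
  have h0 : MvPolynomial.map (Polynomial.evalRingHom 0) Fam = X 0 ^ (d - 1) * X 1 := by
    rw [hmap, sum_eq_single 0]
    · rw [pow_zero, mul_one, zero_add, Nat.choose_one_right, Nat.sub_zero, pow_one,
        div_self (Nat.cast_ne_zero.2 hd.ne'), C_1, one_mul]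
    · intro m _ hm
      rw [zero_pow hm, mul_zero, C_0, zero_mul, zero_mul]
    · intro h
      exact absurd (mem_range.2 hd) h
  have h := coeffVec_map_eval_zero_mem_zariskiClosure_of_family (waringSums F 2 d 2) Fam
    (fun t ht => by rw [hmap]; exact family_mem_waringSums_two hd ht)
  rwa [h0] at h

/-- **`W̲R(x^{d-1} y) ≤ 2`** for the tree's `borderPolyWaringRank`.
[cite: BlaserDorflerIkenmeyer2020, Cor 14 (arXiv; = CCC 2021 Cor 6.8), proof] -/
theorem borderPolyWaringRank_X_pow_mul_X_le_two [IsAlgClosed F] [CharZero F] {d : ℕ} (hd : 0 < d) :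
    borderPolyWaringRank d (X 0 ^ (d - 1) * X 1 : MvPolynomial (Fin 2) F) ≤ 2 :=
  borderPolyWaringRank_le (isBorderWaringRankLE_two_X_pow_mul_X hd)

/-- **`ncw(x^{d-1} y) ≤ 2`** over `ℂ`: by the PROVED chain `w ≤ ncw ≤ W̲R` of BDI Thm 4.2
(`BDI2020_thm_4_2_chain_holds`) and `W̲R(x^{d-1} y) ≤ 2`. (Directly: the width-2 ncABP with
states "no `y` yet" / "one `y` seen" computes the symmetric tensor `(1/d) Σ_k e_x^{⊗k} ⊗ e_y ⊗
e_x^{⊗(d-1-k)}`.) [cite: BlaserDorflerIkenmeyer2020, Thm 2 and Cor 14 (arXiv; = CCC 2021 Thm 4.2, Cor 6.8)] -/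
theorem ncAbpWidthPoly_X_pow_mul_X_le_two {d : ℕ} (hd : 0 < d) :
    BDI2020.ncAbpWidthPoly d (X 0 ^ (d - 1) * X 1 : MvPolynomial (Fin 2) ℂ) ≤ 2 :=
  (BDI2020_thm_4_2_chain_holds 2 d _ (isHomogeneous_X_pow_mul_X hd) hd).2.trans
    (borderPolyWaringRank_X_pow_mul_X_le_two hd)


/-! ### The Waring rank of `x^{d-1} y` is exactly `d`: an explicit decomposition by roots of unity -/

/-- Root-of-unity filter: `∑_{k<d} ζ^{k n} = d` if `ζ^n = 1` and `= 0` otherwise, for a primitive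
`d`-th root of unity `ζ`. [folklore] -/
private theorem sum_pow_mul_eq_ite {ζ : F} {d : ℕ} (hζ : IsPrimitiveRoot ζ d) (n : ℕ) :
    ∑ k ∈ range d, ζ ^ (k * n) = if ζ ^ n = 1 then (d : F) else 0 := by
  have h : ∀ k : ℕ, ζ ^ (k * n) = (ζ ^ n) ^ k := fun k => by rw [mul_comm, pow_mul]
  simp_rw [h]
  split_ifs with h1
  · simp [h1]
  · rw [geom_sum_eq h1, ← pow_mul, mul_comm, pow_mul, hζ.pow_eq_one, one_pow, sub_self, zero_div]

/-- Rearranging one term of the binomial expansion. [folklore] -/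
private theorem term_rearrange (a b : F) (j d c : ℕ) :
    C a * ((X 0 : MvPolynomial (Fin 2) F) ^ j * (C b * X 1) ^ (d - j) * (c : MvPolynomial (Fin 2) F)) =
      C (a * b ^ (d - j) * c) * X 0 ^ j * X 1 ^ (d - j) := by
  rw [mul_pow, ← C_pow, ← map_natCast (C : F →+* MvPolynomial (Fin 2) F) c, C_mul, C_mul]
  ring

/-- **The roots-of-unity decomposition**: for a primitive `d`-th root of unity `ζ`, `d ≥ 2`,
`∑_{k<d} ζ^{k(d-1)} (x + ζ^k y)^d = d² · x^{d-1} y` (only the coefficient of `x^{d-1} y` survives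
the filter `∑_k ζ^{k(2d-1-j)}`). [cite: CarliniCatalisanoGeramita2012, Cor 3.3, proof (arXiv:1110.0745 p0005.txt:L81-89: the `d` apolar points `y_2^{d} − y_1^{d} = 0`)] -/
theorem sum_rootOfUnity_mul_pow_eq {d : ℕ} (hd : 2 ≤ d) {ζ : F} (hζ : IsPrimitiveRoot ζ d) :
    ∑ k ∈ range d, C (ζ ^ (k * (d - 1))) * (X 0 + C (ζ ^ k) * X 1 : MvPolynomial (Fin 2) F) ^ d =
      C ((d : F) ^ 2) * X 0 ^ (d - 1) * X 1 := by
  have hexp : ∀ k ∈ range d,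
      C (ζ ^ (k * (d - 1))) * (X 0 + C (ζ ^ k) * X 1 : MvPolynomial (Fin 2) F) ^ d =
        ∑ j ∈ range (d + 1), C (ζ ^ (k * (2 * d - 1 - j)) * (d.choose j : ℕ)) * X 0 ^ j * X 1 ^ (d - j) := by
    intro k _
    rw [add_pow, mul_sum]
    refine sum_congr rfl fun j hj => ?_
    have hj' : j ≤ d := Nat.lt_succ_iff.1 (mem_range.1 hj)
    rw [term_rearrange, ← pow_mul, ← pow_add, show k * (d - 1) + k * (d - j) = k * (2 * d - 1 - j) by
      rw [← mul_add]; congr 1; omega]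
  rw [sum_congr rfl hexp, sum_comm]
  have hinner : ∀ j ∈ range (d + 1),
      ∑ k ∈ range d, C (ζ ^ (k * (2 * d - 1 - j)) * (d.choose j : ℕ)) * (X 0 : MvPolynomial (Fin 2) F) ^ j *
          X 1 ^ (d - j) =
        C ((if ζ ^ (2 * d - 1 - j) = 1 then (d : F) else 0) * (d.choose j : ℕ)) * X 0 ^ j * X 1 ^ (d - j) := by
    intro j _
    rw [← sum_mul, ← sum_mul, ← map_sum, ← sum_mul, sum_pow_mul_eq_ite hζ]
  rw [sum_congr rfl hinner, sum_eq_single (d - 1)]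
  · have h1 : ζ ^ (2 * d - 1 - (d - 1)) = 1 := by
      rw [show 2 * d - 1 - (d - 1) = d by omega, hζ.pow_eq_one]
    rw [if_pos h1, show d - (d - 1) = 1 by omega, pow_one, show d.choose (d - 1) = d by
      rw [Nat.choose_symm (by omega), Nat.choose_one_right], sq]
  · intro j hj hne
    have hj' : j ≤ d := Nat.lt_succ_iff.1 (mem_range.1 hj)
    have hne1 : ζ ^ (2 * d - 1 - j) ≠ 1 := by
      rw [Ne, hζ.pow_eq_one_iff_dvd]
      rintro ⟨c, hc⟩
      rcases Nat.lt_or_ge c 2 with hc2 | hc2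
      · interval_cases c <;> omega
      · have : d * 2 ≤ d * c := Nat.mul_le_mul_left d hc2
        omega
    rw [if_neg hne1, zero_mul, C_0, zero_mul, zero_mul]
  · intro h
    exact absurd (mem_range.2 (by omega)) h

/-- **`WR(x^{d-1} y) ≤ d` over `ℂ`**: `x^{d-1} y = ∑_{k<d} (μ_k (x + ζ^k y))^d` with `ζ = e^{2πi/d}`
and `μ_k^d = ζ^{k(d-1)}/d²` (`d ≥ 2`; for `d = 1`, `y = y^1`).
[cite: CarliniCatalisanoGeramita2012, Cor 3.3, proof (arXiv:1110.0745 p0005.txt:L81-89: the apolar points `(y_2^{b_2+1} − y_1^{b_2+1})`, i.e. `[1 : ζ^k]`)] -/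
theorem polyWaringRank_X_pow_mul_X_le (d : ℕ) :
    polyWaringRank d (X 0 ^ (d - 1) * X 1 : MvPolynomial (Fin 2) ℂ) ≤ d := by
  rcases Nat.lt_or_ge d 2 with hd | hd
  · interval_cases d
    · exact Nat.le_of_eq (by
        rw [pow_zero, one_mul]
        -- `polyWaringRank 0 y = 0`: no decomposition into `0`-th powers (sums of ones are constants)
        unfold polyWaringRank sComplexity
        rw [Nat.sInf_eq_zero]
        right
        rw [Set.eq_empty_iff_forall_notMem]
        rintro s ⟨g, hg, hsum⟩
        have hc : ∀ i, g i = 1 := fun i => by obtain ⟨a, ha⟩ := hg i; rw [← ha, pow_zero]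
        have h1 := congrArg (coeff (Finsupp.single (1 : Fin 2) 1)) hsum
        rw [coeff_sum, coeff_X] at h1
        simp only [hc, ← C_1, coeff_C] at h1
        have hne : (0 : Fin 2 →₀ ℕ) ≠ Finsupp.single 1 1 := (Finsupp.single_ne_zero.2 one_ne_zero).symm
        rw [if_neg hne, sum_const_zero] at h1
        simp at h1)
    · refine polyWaringRank_le_of_eq_sum ![![0, 1]] ?_
      rw [Fin.sum_univ_one, Matrix.cons_val_zero, linearForm_fin_two]
      simp
  -- `d ≥ 2`
  have hd0 : d ≠ 0 := by omega
  set ζ : ℂ := Complex.exp (2 * Real.pi * Complex.I / d) with hζdef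
  have hζ : IsPrimitiveRoot ζ d := Complex.isPrimitiveRoot_exp d hd0
  have hμ : ∀ k : Fin d, ∃ μ : ℂ, μ ^ d = ζ ^ ((k : ℕ) * (d - 1)) / (d : ℂ) ^ 2 := fun k =>
    IsAlgClosed.exists_pow_nat_eq _ (by omega)
  choose μ hμ using hμ
  refine polyWaringRank_le_of_eq_sum (fun k => μ k • ![1, ζ ^ (k : ℕ)]) ?_
  have hdC : (d : ℂ) ^ 2 ≠ 0 := pow_ne_zero 2 (Nat.cast_ne_zero.2 hd0)
  calc ∑ k : Fin d, linearForm (μ k • ![1, ζ ^ (k : ℕ)]) ^ d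
      = ∑ k : Fin d, C ((d : ℂ) ^ 2)⁻¹ * (C (ζ ^ ((k : ℕ) * (d - 1))) *
          (X 0 + C (ζ ^ (k : ℕ)) * X 1 : MvPolynomial (Fin 2) ℂ) ^ d) := by
        refine sum_congr rfl fun k _ => ?_
        rw [linearForm_fin_two]
        simp only [Pi.smul_apply, Matrix.cons_val_zero, Matrix.cons_val_one, smul_eq_mul, mul_one]
        rw [show (C (μ k) * X 0 + C (μ k * ζ ^ (k : ℕ)) * X 1 : MvPolynomial (Fin 2) ℂ) =
            C (μ k) * (X 0 + C (ζ ^ (k : ℕ)) * X 1) by rw [C_mul]; ring,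
          mul_pow, ← C_pow, hμ, ← mul_assoc, ← C_mul, div_eq_inv_mul]
    _ = C ((d : ℂ) ^ 2)⁻¹ * ∑ k ∈ range d, C (ζ ^ (k * (d - 1))) *
          (X 0 + C (ζ ^ k) * X 1 : MvPolynomial (Fin 2) ℂ) ^ d := by
        rw [mul_sum, Fin.sum_univ_eq_sum_range (fun k => C ((d : ℂ) ^ 2)⁻¹ *
          (C (ζ ^ (k * (d - 1))) * (X 0 + C (ζ ^ k) * X 1 : MvPolynomial (Fin 2) ℂ) ^ d)) d]
    _ = X 0 ^ (d - 1) * X 1 := by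
        rw [sum_rootOfUnity_mul_pow_eq hd hζ, ← mul_assoc, ← mul_assoc, ← C_mul, inv_mul_cancel₀ hdC,
          C_1, one_mul]

/-- **`WR(x^{d-1} y) = d` over `ℂ`** [carlini2012solution] — the value quoted in the proof of
BDI Cor 6.8: "showing that `x^{d-1} y` has Waring rank `d`". For the tree's `polyWaringRank`.
[cite: CarliniCatalisanoGeramita2012, Cor 3.3 (rank of monomials, arXiv:1110.0745 p0005.txt:L61-66; `x^{d-1}y = x_1^{1} x_2^{d-1}`: `b_2 + 1 = d`)];
quoted at [BlaserDorflerIkenmeyer2020, Cor 14 (arXiv; = CCC 2021 Cor 6.8), proof, p0012.txt:L36]. -/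
theorem polyWaringRank_X_pow_mul_X_eq (d : ℕ) :
    polyWaringRank d (X 0 ^ (d - 1) * X 1 : MvPolynomial (Fin 2) ℂ) = d :=
  le_antisymm (polyWaringRank_X_pow_mul_X_le d) (le_polyWaringRank_X_pow_mul_X d)

end BDI20WaringGap

open BDI20WaringGap

/-! ### BDI Cor 6.8 (arXiv Cor 14): the strict inclusion `W_{2,d} ⊊ W̲_{2,d}`, and Question 6.9 (a) -/

/-- **BDI Cor 6.8 (arXiv Cor 14), the first strict inclusion `W_{k,d} ⊊ W̲_{k,d}`**, witnessed as in
the printed proof by `x^{d-1} y` (`k = 2`, every `d ≥ 3`): "we refer to [carlini2012solution]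
showing that `x^{d-1} y` has Waring rank `d` while it is known that `x^{d-1} y =
lim_{ε→0} (1/(dε)) ((x+εy)^d − x^d)` and thus `x^{d-1} y` has border Waring rank at most `2`."
Typed over the tree's `polyWaringRank` / `borderPolyWaringRank`, over `ℂ` as printed.
[cite: BlaserDorflerIkenmeyer2020, Cor 14 (arXiv; = CCC 2021 Cor 6.8)] locator:
paper:arxiv-2002.11594 p0012.txt:L21-36; CCC p.29:13–29:14. -/
theorem BDI2020_cor_6_8_waring_lt_of_border {d : ℕ} (hd : 3 ≤ d) :
    borderPolyWaringRank d (X 0 ^ (d - 1) * X 1 : MvPolynomial (Fin 2) ℂ) ≤ 2 ∧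
      2 < polyWaringRank d (X 0 ^ (d - 1) * X 1 : MvPolynomial (Fin 2) ℂ) :=
  ⟨borderPolyWaringRank_X_pow_mul_X_le_two (by omega),
    lt_of_lt_of_le (by omega) (le_polyWaringRank_X_pow_mul_X d)⟩

/-- **BDI Question 6.9 (arXiv Question 15), first alternative, decided AS TYPED: no.** The typed
`BDI2020_question_6_9a` asks for ONE polynomially bounded `q` with `WR(p) ≤ q(k)` whenever
`ncw(p) ≤ k`, uniformly in the degree `d` (and in `m`) — the literal reading of "Is there a
polynomial `q`, such that `B_{k,d} ⊆ W_{q(k),d}`". The example of the paper's own Cor 6.8 settles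
it: `ncw(x^{d-1} y) ≤ W̲R(x^{d-1} y) ≤ 2` for every `d` (Thm 4.2), while `WR(x^{d-1} y) = d`
[carlini2012solution]; take `d = q(2) + 1`. (No `q : ℕ → ℕ` whatsoever works; p-boundedness is
not used.) HONEST SCOPE: this decides the typed, `d`-uniform reading only; a reading in which `q`
may also depend polynomially on `d` is not addressed here, and the second alternative
`BDI2020_question_6_9b` (border Waring rank polynomial in `ncw`) is untouched — both remain open as
far as this file is concerned. [cite: BlaserDorflerIkenmeyer2020, Question 15 and Cor 14 (arXiv; = CCC 2021 Question 6.9, Cor 6.8)]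
locator: paper:arxiv-2002.11594 p0012.txt:L21-36 (Cor 14, proof), L63-66 (Question 15). -/
theorem not_BDI2020_question_6_9a : ¬ BDI2020_question_6_9a := by
  rintro ⟨q, -, hq⟩
  have h := hq 2 (q 2 + 1) 2 (X 0 ^ (q 2 + 1 - 1) * X 1) (isHomogeneous_X_pow_mul_X (Nat.succ_pos _))
    (Nat.succ_pos _) (ncAbpWidthPoly_X_pow_mul_X_le_two (Nat.succ_pos _))
  have h' := le_polyWaringRank_X_pow_mul_X (F := ℂ) (q 2 + 1)
  omega


end Literature.Computability.AlgebraicComplexity
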